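import Summits.QuantumFields.YangMills.Theorems.BalabanUVNodesN19LawPriceSymmetric
import Literature.Analysis.Quadrature.JacksonBoundedDerivProofs
import Mathlib.LinearAlgebra.Lagrange
import Mathlib.Analysis.Calculus.Deriv.Shift

/-!
# YM-DAG node N19 (= NE7 proper) — THE LAW-LEVEL PRICE IS LOGARITHMIC, VI: the JACKSON road (rate `1∕n` replaces Bernstein's `1∕√n`)

Cell `pub-ymgap`, HUMAN RULING D-0062 (Track A), R141 (C) wider-strategy seat `pub-ymgap-dag-n19-e` (strategy s3 = ALTERNATIVE CURRENCY), generation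
g18, module 2.  Route `Summits/QuantumFields/YangMills/Theses/BalabanUVNodes.lean` rev 25, cluster item K3⁷ «SpineGivenEndpointR13SepCoPH»
(stmt-QuantumFields-20544, dag-lead WORDS-143); filed `--supports` that item `--as helper` (it proves no registered stub).  COUNT-NEUTRAL: elementary real
analysis ∕ algebra over Mathlib (`Continuous.integral_hasStrictDerivAt`, `Lagrange.eq_interpolate`, `Polynomial.eval_eq_sum_range'`) + the TREE's
`Literature.Analysis.Quadrature.JacksonBoundedDeriv_holds` (Jackson's theorem for an integrand with a bounded derivative, Davis–Rabinowitz (4.8.7),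
discharged in `Literature/Analysis/Quadrature/JacksonBoundedDerivProofs.lean`) BY NAME + the seat's p546312 `…N19LawPriceUpper`
(`abs_moment_sub_le_of_cgf_close`) ∕ p550501 `…N19LawPriceSymmetric` (`ae_abs_le_one_of_Icc_symm`) BY NAME; no scheme object, no Theses import;
NOT a discharge claim.

THE POINT.  p546312 ∕ p548987 ∕ p550501 bound the bounded-Lipschitz distance of two laws whose cgf's are `ε`-close on a window by `K∕√n + C(n,l₀)·ε`
(`n`-th BERNSTEIN polynomial of the test function: rate `n^{−1∕2}` on the Lipschitz class), whence a modulus `√(log(e+L)∕(1+L))`-shaped at best,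
against the lower rate `log(e+L)∕(1+L)` of p543481 ∕ `…N19LawPriceLowerRate`.  The gap is Bernstein's, not the problem's: JACKSON's theorem gives rate
`1∕n`.  This module runs the Jackson road with the tree's typed Jackson theorem:
* §1 JACKSON FOR THE LIPSCHITZ CLASS (★ `exists_poly_near_of_lipschitzWith`): a `K`-Lipschitz `g` is within `4(b−a)K∕n` of a polynomial of degree `≤ n`
  on `[a,b]` — Steklov smoothing `s_h(x) = h⁻¹∫_x^{x+h} g` (`|s_h′| ≤ K`, `|s_h − g| ≤ Kh`, `h = (b−a)∕n`) + `JacksonBoundedDeriv_holds` (`3(b−a)K∕n`).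
* §2 THE PRICE OF A POLYNOMIAL: `ℓ¹` coefficient sums `Λ_d(q) = ∑_{i≤d} |[xⁱ]q|` under multiplication by linear factors, and the LAGRANGE BASIS at the
  `n+1` equispaced nodes `x_j = −1 + 2j∕n` of `[−1,1]`: `Λ_n(ℓ_j) ≤ nⁿ` (each factor `(X − x_i)∕(x_j − x_i)` costs `(1+|x_i|)∕|x_j − x_i| ≤ n`).
* §3 PAIRING WITH TWO LAWS on `[−1,1]` whose moment differences of orders `1 ≤ i ≤ n` are `≤ D`: `|∫ q dν − ∫ q dμ| ≤ Λ_n(q)·D`, and for ANY polynomial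
  `p` of degree `≤ n` with `|p(x_j)| ≤ P` at the nodes, `|∫ p dν − ∫ p dμ| ≤ (n+1)·P·nⁿ·D` (Lagrange: `p = ∑_j p(x_j)ℓ_j`) — the sup-norm of `p` is
  converted into the moment currency at cost `e^{O(n log n)}`, the same order the currency itself carries (`D = n!·2εe^{l₀}·Aⁿ`, p546312 §2).
* §4 ★★ `abs_integral_sub_integral_le_lipschitz_jackson`: laws `μ, ν` on `[−1,1]`, cgf's `ε`-close on `|t| ≤ l₀`, `g` `K`-Lipschitz with `|g| ≤ G` on
  `[−1,1]`: for every `n ≥ 1`, `|∫ g dν − ∫ g dμ| ≤ 16K∕n + (n+1)·(G + 8K∕n)·nⁿ·(n!·2εe^{l₀}·Aⁿ)`, `A = max(1, 2e·max(1,log⁺ε⁻¹)∕l₀)`.  The sibling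
  `…N19LawPriceTwoSided` optimises `n ≍ (1+L)∕log(e+L)` ⇒ `C(l₀)(K+G)·log(e+L)∕(1+L)`, matching the lower rate: the law-level price two-sided.

HONEST FRAMING (binding).  Elementary and [folklore: D. Jackson 1911; Steklov means; Lagrange interpolation]; NO consumer in the DAG today (optimality
of the seat's own currency: what g9's continuum law p504707 ∕ p505344 can carry).  Nothing of Bałaban's is instantiated; NE7 ∕ NE7b ∕ NE7c NOT PRINTED,
NOT proved; N19 NOT discharged; count-neutral.  One finite `T⁴` programme at fixed `ε`; nothing continuum ∕ `ℝ⁴` ∕ OS ∕ mass-gap ∕ Clay.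
0 `def` ∕ 0 `sorry`.
-/

noncomputable section

open Real Finset MeasureTheory ProbabilityTheory Polynomial

namespace Summit.QuantumFields.YangMills.Theorems.BalabanUVNodesN19LawPriceJackson

open Summit.QuantumFields.YangMills.Theorems.BalabanUVNodesN19LawPriceUpper (abs_moment_sub_le_of_cgf_close)
open Summit.QuantumFields.YangMills.Theorems.BalabanUVNodesN19LawPriceSymmetric (ae_abs_le_one_of_Icc_symm)

/-! ## §1 Jackson's theorem for the Lipschitz class (Steklov smoothing + the tree's `JacksonBoundedDeriv_holds`) -/

/-- **STEKLOV SMOOTHING.**  For a `K`-Lipschitz `g : ℝ → ℝ` and `h > 0`, the Steklov mean `s(x) = (G(x+h) − G(x))∕h`, `G(x) = ∫₀ˣ g`, is differentiable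
with `s′(x) = (g(x+h) − g(x))∕h`, `|s′| ≤ K`, and `|g − s| ≤ Kh` everywhere. [folklore] -/
theorem steklov_hasDerivAt {g : ℝ → ℝ} {K : NNReal} (hg : LipschitzWith K g) {h : ℝ} (hh : 0 < h) (x : ℝ) :
    HasDerivAt (fun x => ((∫ y in (0 : ℝ)..(x + h), g y) - ∫ y in (0 : ℝ)..x, g y) / h) ((g (x + h) - g x) / h) x ∧
      |(g (x + h) - g x) / h| ≤ K ∧
      |g x - ((∫ y in (0 : ℝ)..(x + h), g y) - ∫ y in (0 : ℝ)..x, g y) / h| ≤ K * h := by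
  have hgc : Continuous g := hg.continuous
  have hG : ∀ z : ℝ, HasDerivAt (fun u => ∫ y in (0 : ℝ)..u, g y) (g z) z := fun z =>
    (hgc.integral_hasStrictDerivAt 0 z).hasDerivAt
  refine ⟨?_, ?_, ?_⟩
  · have h1 : HasDerivAt (fun u => ∫ y in (0 : ℝ)..(u + h), g y) (g (x + h)) x :=
      HasDerivAt.comp_add_const x h (hG (x + h))
    exact (h1.sub (hG x)).div_const h
  · rw [abs_div, abs_of_pos hh, div_le_iff₀ hh]
    have h1 := hg.dist_le_mul (x + h) x
    rw [Real.dist_eq, Real.dist_eq, add_sub_cancel_left, abs_of_pos hh] at h1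
    exact h1
  · have hint : ∀ a b : ℝ, IntervalIntegrable g volume a b := fun a b => hgc.intervalIntegrable a b
    rw [intervalIntegral.integral_interval_sub_left (hint 0 (x + h)) (hint 0 x)]
    have hconst : ∫ _ in x..(x + h), g x = h * g x := by
      rw [intervalIntegral.integral_const, add_sub_cancel_left, smul_eq_mul]
    have hsub : (∫ y in x..(x + h), g y) - h * g x = ∫ y in x..(x + h), (g y - g x) := by
      rw [intervalIntegral.integral_sub (hint x (x + h)) intervalIntegrable_const, hconst]
    have hbound : |∫ y in x..(x + h), (g y - g x)| ≤ K * h * |x + h - x| := by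
      have h1 := intervalIntegral.norm_integral_le_of_norm_le_const (a := x) (b := x + h) (C := K * h)
        (f := fun y => g y - g x) fun y hy => ?_
      · simpa only [Real.norm_eq_abs] using h1
      · rw [Set.uIoc_of_le (by linarith), Set.mem_Ioc] at hy
        rw [Real.norm_eq_abs]
        have h2 := hg.dist_le_mul y x
        rw [Real.dist_eq, Real.dist_eq, abs_of_pos (by linarith : 0 < y - x)] at h2
        exact h2.trans (mul_le_mul_of_nonneg_left (by linarith) K.2)
    rw [add_sub_cancel_left, abs_of_pos hh] at hbound
    calc |g x - (∫ y in x..(x + h), g y) / h| = |∫ y in x..(x + h), (g y - g x)| / h := by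
          rw [← hsub, ← abs_of_pos hh, ← abs_div, abs_of_pos hh, sub_div, mul_div_cancel_left₀ _ hh.ne', abs_sub_comm]
      _ ≤ K * h * h / h := div_le_div_of_nonneg_right hbound hh.le
      _ = K * h := mul_div_cancel_right₀ _ hh.ne'

/-- **★ JACKSON'S THEOREM FOR THE LIPSCHITZ CLASS.**  A `K`-Lipschitz `g : ℝ → ℝ` is, on every `[a, b]` and for every `n ≥ 1`, within `4(b−a)K∕n` of a
real polynomial of degree `≤ n` — the tree's `Literature.Analysis.Quadrature.JacksonBoundedDeriv_holds` (`|f′| ≤ M ⇒ 3(b−a)M∕n`, Davis–Rabinowitz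
(4.8.7) after D. Jackson) applied to the Steklov mean with `h = (b−a)∕n` (`|s′| ≤ K`, `|g − s| ≤ (b−a)K∕n`).  Rate `1∕n`, versus the `1∕√n` of
Bernstein polynomials (p546312 `abs_bernstein_sum_sub_le`). [folklore] -/
theorem exists_poly_near_of_lipschitzWith {g : ℝ → ℝ} {K : NNReal} (hg : LipschitzWith K g) {a b : ℝ} (hab : a ≤ b)
    {n : ℕ} (hn : 0 < n) :
    ∃ p : ℝ[X], p.natDegree ≤ n ∧ ∀ x ∈ Set.Icc a b, |g x - p.eval x| ≤ 4 * (b - a) * K / n := by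
  rcases eq_or_lt_of_le hab with rfl | hlt
  · refine ⟨Polynomial.C (g a), by simp, fun x hx => ?_⟩
    have : x = a := le_antisymm hx.2 hx.1
    simp [this]
  · have hnr : (0 : ℝ) < n := by exact_mod_cast hn
    set h : ℝ := (b - a) / n with hh_def
    have hh : 0 < h := div_pos (by linarith) hnr
    set s : ℝ → ℝ := fun x => ((∫ y in (0 : ℝ)..(x + h), g y) - ∫ y in (0 : ℝ)..x, g y) / h with hs
    set s' : ℝ → ℝ := fun x => (g (x + h) - g x) / h with hs'
    have hder : ∀ x ∈ Set.Icc a b, HasDerivAt s (s' x) x := fun x _ => (steklov_hasDerivAt hg hh x).1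
    have hM : ∀ x ∈ Set.Icc a b, |s' x| ≤ K := fun x _ => (steklov_hasDerivAt hg hh x).2.1
    obtain ⟨p, hp, hsp⟩ := Literature.Analysis.Quadrature.JacksonBoundedDeriv_holds a b hab s s' K hder hM n hn
    refine ⟨p, hp, fun x hx => ?_⟩
    have h1 : |g x - s x| ≤ K * h := (steklov_hasDerivAt hg hh x).2.2
    calc |g x - p.eval x| = |(g x - s x) + (s x - p.eval x)| := by ring_nf
      _ ≤ |g x - s x| + |s x - p.eval x| := abs_add_le _ _
      _ ≤ K * h + 3 * (b - a) * K / n := add_le_add h1 (hsp x hx)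
      _ = 4 * (b - a) * K / n := by rw [hh_def]; ring

/-! ## §2 `ℓ¹` coefficient sums under linear factors; the Lagrange basis at equispaced nodes costs `nⁿ` -/

/-- Multiplying by a constant scales the `ℓ¹` coefficient sum `Λ_d(q) = ∑_{i ≤ d} |[xⁱ]q|`. [folklore] -/
theorem sum_abs_coeff_C_mul (c : ℝ) (q : ℝ[X]) (d : ℕ) :
    ∑ i ∈ range (d + 1), |(Polynomial.C c * q).coeff i| = |c| * ∑ i ∈ range (d + 1), |q.coeff i| := by
  rw [mul_sum]
  exact sum_congr rfl fun i _ => by rw [Polynomial.coeff_C_mul, abs_mul]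

/-- Multiplying by `X` does not increase `Λ_d`. [folklore] -/
theorem sum_abs_coeff_X_mul_le (q : ℝ[X]) (d : ℕ) :
    ∑ i ∈ range (d + 1), |(X * q).coeff i| ≤ ∑ i ∈ range (d + 1), |q.coeff i| := by
  have h : ∑ i ∈ range (d + 1), |(X * q).coeff i| = ∑ i ∈ range d, |q.coeff i| := by
    rw [Finset.sum_range_succ']
    simp only [Polynomial.coeff_X_mul, Polynomial.coeff_X_mul_zero, abs_zero, add_zero]
  rw [h]
  exact Finset.sum_le_sum_of_subset_of_nonneg (Finset.range_subset_range.2 (Nat.le_succ d)) fun i _ _ => abs_nonneg _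

/-- A linear factor costs `1 + |y|`: `Λ_d((X − y)·q) ≤ (1 + |y|)·Λ_d(q)`. [folklore] -/
theorem sum_abs_coeff_X_sub_C_mul_le (y : ℝ) (q : ℝ[X]) (d : ℕ) :
    ∑ i ∈ range (d + 1), |((X - Polynomial.C y) * q).coeff i| ≤ (1 + |y|) * ∑ i ∈ range (d + 1), |q.coeff i| := by
  have h : ∀ i, ((X - Polynomial.C y) * q).coeff i = (X * q).coeff i - (Polynomial.C y * q).coeff i := fun i => by
    rw [sub_mul, Polynomial.coeff_sub]
  calc ∑ i ∈ range (d + 1), |((X - Polynomial.C y) * q).coeff i|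
      ≤ ∑ i ∈ range (d + 1), (|(X * q).coeff i| + |(Polynomial.C y * q).coeff i|) :=
        sum_le_sum fun i _ => by rw [h i]; exact abs_sub _ _
    _ = ∑ i ∈ range (d + 1), |(X * q).coeff i| + ∑ i ∈ range (d + 1), |(Polynomial.C y * q).coeff i| := sum_add_distrib
    _ ≤ ∑ i ∈ range (d + 1), |q.coeff i| + |y| * ∑ i ∈ range (d + 1), |q.coeff i| :=
        add_le_add (sum_abs_coeff_X_mul_le q d) (by rw [sum_abs_coeff_C_mul])
    _ = (1 + |y|) * ∑ i ∈ range (d + 1), |q.coeff i| := by ring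

/-- A Lagrange divisor `(X − y)∕(x − y)` costs `(1 + |y|)∕|x − y|`. [folklore] -/
theorem sum_abs_coeff_basisDivisor_mul_le (x y : ℝ) (q : ℝ[X]) (d : ℕ) :
    ∑ i ∈ range (d + 1), |(Lagrange.basisDivisor x y * q).coeff i| ≤
      (|x - y|⁻¹ * (1 + |y|)) * ∑ i ∈ range (d + 1), |q.coeff i| := by
  rw [Lagrange.basisDivisor, mul_assoc, sum_abs_coeff_C_mul, abs_inv, mul_assoc]
  exact mul_le_mul_of_nonneg_left (sum_abs_coeff_X_sub_C_mul_le y q d) (by positivity)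

/-- `Λ_d(1) = 1`. [folklore] -/
theorem sum_abs_coeff_one (d : ℕ) : ∑ i ∈ range (d + 1), |(1 : ℝ[X]).coeff i| = 1 := by
  rw [Finset.sum_range_succ']
  simp [Polynomial.coeff_one]

/-- A product of Lagrange divisors with node `x` over a finite set of other nodes, each costing `≤ B` (`0 ≤ B`), costs `≤ B^{#s}`. [folklore] -/
theorem sum_abs_coeff_prod_basisDivisor_le {ι : Type*} [DecidableEq ι] (s : Finset ι) (v : ι → ℝ) (x : ℝ) {B : ℝ} (hB : 0 ≤ B)
    (hcost : ∀ i ∈ s, |x - v i|⁻¹ * (1 + |v i|) ≤ B) (d : ℕ) :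
    ∑ i ∈ range (d + 1), |(∏ j ∈ s, Lagrange.basisDivisor x (v j)).coeff i| ≤ B ^ s.card := by
  induction s using Finset.induction_on with
  | empty => simp [sum_abs_coeff_one]
  | @insert j s hj ih =>
    rw [Finset.prod_insert hj, Finset.card_insert_of_notMem hj, pow_succ']
    have hih := ih fun i hi => hcost i (Finset.mem_insert_of_mem hi)
    calc ∑ i ∈ range (d + 1), |(Lagrange.basisDivisor x (v j) * ∏ j ∈ s, Lagrange.basisDivisor x (v j)).coeff i|
        ≤ (|x - v j|⁻¹ * (1 + |v j|)) * ∑ i ∈ range (d + 1), |(∏ j ∈ s, Lagrange.basisDivisor x (v j)).coeff i| :=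
          sum_abs_coeff_basisDivisor_mul_le _ _ _ _
      _ ≤ B * B ^ s.card := mul_le_mul (hcost j (Finset.mem_insert_self j s)) hih (by positivity) hB

/-- **THE LAGRANGE BASIS AT THE EQUISPACED NODES `x_j = −1 + 2j∕n` (`j = 0,…,n`) COSTS `nⁿ`.**  `Λ_d(ℓ_j) ≤ nⁿ` for every `d` and every node `j ≤ n`
(each divisor costs `(1 + |x_i|)∕|x_j − x_i| ≤ 2∕(2∕n) = n`; `n` divisors). [folklore] -/
theorem sum_abs_coeff_lagrange_basis_le {n : ℕ} (hn : 0 < n) {j : ℕ} (hj : j ∈ range (n + 1)) (d : ℕ) :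
    ∑ i ∈ range (d + 1), |(Lagrange.basis (range (n + 1)) (fun i : ℕ => -1 + 2 * (i : ℝ) / n) j).coeff i| ≤ (n : ℝ) ^ n := by
  have hnr : (0 : ℝ) < n := by exact_mod_cast hn
  have hcard : ((range (n + 1)).erase j).card = n := by
    rw [Finset.card_erase_of_mem hj, Finset.card_range, Nat.add_sub_cancel]
  rw [Lagrange.basis]
  refine le_trans (sum_abs_coeff_prod_basisDivisor_le (ι := ℕ) ((range (n + 1)).erase j)
    (fun i : ℕ => -1 + 2 * (i : ℝ) / n) _ hnr.le (fun i hi => ?_) d) (le_of_eq (by rw [hcard]))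
  have hij : i ≠ j := Finset.ne_of_mem_erase hi
  have hi' : i ≤ n := Nat.lt_succ_iff.mp (mem_range.mp (Finset.mem_of_mem_erase hi))
  -- `|x_i| ≤ 1`
  have hi_le : (i : ℝ) ≤ n := by exact_mod_cast hi'
  have h0i : (0 : ℝ) ≤ 2 * (i : ℝ) / n := by positivity
  have h2i : 2 * (i : ℝ) / n ≤ 2 := by rw [div_le_iff₀ hnr]; linarith
  have habs : |(-1 + 2 * (i : ℝ) / n)| ≤ 1 := abs_le.2 ⟨by linarith, by linarith⟩
  -- `|x_j − x_i| ≥ 2∕n`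
  have hdiff : 2 / n ≤ |(-1 + 2 * (j : ℝ) / n) - (-1 + 2 * (i : ℝ) / n)| := by
    rw [show (-1 + 2 * (j : ℝ) / n) - (-1 + 2 * (i : ℝ) / n) = 2 / n * ((j : ℝ) - i) by ring, abs_mul,
      abs_of_pos (by positivity : (0 : ℝ) < 2 / n)]
    refine le_mul_of_one_le_right (by positivity) ?_
    have h1 : (1 : ℤ) ≤ |(j : ℤ) - i| := Int.one_le_abs (sub_ne_zero.2 (by exact_mod_cast hij.symm))
    have h2 : ((1 : ℤ) : ℝ) ≤ ((|(j : ℤ) - i| : ℤ) : ℝ) := by exact_mod_cast h1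
    simpa using h2
  have hpos : 0 < |(-1 + 2 * (j : ℝ) / n) - (-1 + 2 * (i : ℝ) / n)| := lt_of_lt_of_le (by positivity) hdiff
  calc |(-1 + 2 * (j : ℝ) / n) - (-1 + 2 * (i : ℝ) / n)|⁻¹ * (1 + |(-1 + 2 * (i : ℝ) / n)|)
      ≤ (2 / (n : ℝ))⁻¹ * 2 :=
        mul_le_mul ((inv_le_inv₀ hpos (by positivity)).2 hdiff) (by linarith) (by positivity) (by positivity)
    _ = n := by rw [inv_div]; field_simp

/-! ## §3 Pairing a polynomial with two laws on `[−1, 1]` at the moment currency -/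

section Laws

variable {μ ν : Measure ℝ} [IsProbabilityMeasure μ] [IsProbabilityMeasure ν]

/-- Under a law on `[−1,1]` every continuous function is integrable. [folklore] -/
theorem integrable_of_continuous_Icc_symm {κ : Measure ℝ} [IsProbabilityMeasure κ] (hκ : κ (Set.Icc (-1) 1)ᶜ = 0) {φ : ℝ → ℝ}
    (hφ : Continuous φ) : Integrable φ κ := by
  obtain ⟨C, hC⟩ := isCompact_Icc.exists_bound_of_continuousOn (hφ.continuousOn (s := Set.Icc (-1 : ℝ) 1))
  have hae : ∀ᵐ x ∂κ, x ∈ Set.Icc (-1 : ℝ) 1 := by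
    rw [ae_iff]
    simpa only [Set.mem_Icc, Set.compl_def] using hκ
  exact Integrable.of_bound hφ.aestronglyMeasurable C (hae.mono fun x hx => hC x hx)

/-- The integral of a polynomial of degree `≤ d` under a law on `[−1,1]` is its coefficients against the moments. [folklore] -/
theorem integral_eval_eq_sum_coeff_mul_moment {κ : Measure ℝ} [IsProbabilityMeasure κ] (hκ : κ (Set.Icc (-1) 1)ᶜ = 0)
    {q : ℝ[X]} {d : ℕ} (hq : q.natDegree ≤ d) :
    ∫ x, q.eval x ∂κ = ∑ i ∈ range (d + 1), q.coeff i * ∫ x, x ^ i ∂κ := by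
  have h : ∀ x : ℝ, q.eval x = ∑ i ∈ range (d + 1), q.coeff i * x ^ i := fun x =>
    Polynomial.eval_eq_sum_range' (Nat.lt_succ_of_le hq) x
  simp_rw [h]
  rw [integral_finsetSum _ fun i _ => (integrable_of_continuous_Icc_symm hκ (by fun_prop)).const_mul _]
  exact sum_congr rfl fun i _ => integral_const_mul _ _

/-- **A POLYNOMIAL AGAINST `ν − μ` COSTS `Λ_d(q)·D`.**  Laws `μ, ν` on `[−1,1]` with `|∫ xⁱ dν − ∫ xⁱ dμ| ≤ D` for `1 ≤ i ≤ d` (`0 ≤ D`; the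
order-`0` difference vanishes: both are probability laws); `q` of degree `≤ d`. [folklore] -/
theorem abs_integral_eval_sub_le (hμ : μ (Set.Icc (-1) 1)ᶜ = 0) (hν : ν (Set.Icc (-1) 1)ᶜ = 0) {d : ℕ} {D : ℝ} (hD0 : 0 ≤ D)
    (hD : ∀ i : ℕ, 1 ≤ i → i ≤ d → |∫ x, x ^ i ∂ν - ∫ x, x ^ i ∂μ| ≤ D) {q : ℝ[X]} (hq : q.natDegree ≤ d) :
    |∫ x, q.eval x ∂ν - ∫ x, q.eval x ∂μ| ≤ (∑ i ∈ range (d + 1), |q.coeff i|) * D := by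
  have hD' : ∀ i ∈ range (d + 1), |∫ x, x ^ i ∂ν - ∫ x, x ^ i ∂μ| ≤ D := by
    intro i hi
    rcases Nat.eq_zero_or_pos i with rfl | hi1
    · simpa only [pow_zero, integral_const, smul_eq_mul, mul_one, probReal_univ, sub_self, abs_zero] using hD0
    · exact hD i hi1 (Nat.lt_succ_iff.mp (mem_range.mp hi))
  rw [integral_eval_eq_sum_coeff_mul_moment hν hq, integral_eval_eq_sum_coeff_mul_moment hμ hq, ← sum_sub_distrib, sum_mul]
  refine (abs_sum_le_sum_abs _ _).trans (sum_le_sum fun i hi => ?_)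
  rw [← mul_sub, abs_mul]
  exact mul_le_mul_of_nonneg_left (hD' i hi) (abs_nonneg _)

/-- **★ ANY POLYNOMIAL OF DEGREE `≤ n` AGAINST `ν − μ`, PRICED BY ITS VALUES AT THE EQUISPACED NODES.**  Laws `μ, ν` on `[−1,1]` with moment
differences `≤ D` in orders `1 ≤ i ≤ n` (`0 ≤ D`, `n ≥ 1`); `p` of degree `≤ n` with `|p(x_j)| ≤ P` at the nodes `x_j = −1 + 2j∕n`, `j ≤ n`.  Then
`|∫ p dν − ∫ p dμ| ≤ (n+1)·P·nⁿ·D` (Lagrange `p = ∑_j p(x_j)ℓ_j`, Mathlib `Lagrange.eq_interpolate`; §2 `Λ_n(ℓ_j) ≤ nⁿ`). [folklore] -/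
theorem abs_integral_eval_sub_le_of_nodes (hμ : μ (Set.Icc (-1) 1)ᶜ = 0) (hν : ν (Set.Icc (-1) 1)ᶜ = 0) {n : ℕ} (hn : 0 < n)
    {D : ℝ} (hD0 : 0 ≤ D) (hD : ∀ i : ℕ, 1 ≤ i → i ≤ n → |∫ x, x ^ i ∂ν - ∫ x, x ^ i ∂μ| ≤ D)
    {p : ℝ[X]} (hp : p.natDegree ≤ n) {P : ℝ} (hP : ∀ j ∈ range (n + 1), |p.eval (-1 + 2 * (j : ℝ) / n)| ≤ P) :
    |∫ x, p.eval x ∂ν - ∫ x, p.eval x ∂μ| ≤ (n + 1) * P * (n : ℝ) ^ n * D := by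
  have hnr : (0 : ℝ) < n := by exact_mod_cast hn
  have hP0 : 0 ≤ P := (abs_nonneg _).trans (hP 0 (by simp))
  set v : ℕ → ℝ := fun i => -1 + 2 * (i : ℝ) / n with hv
  have hinj : Set.InjOn v (range (n + 1) : Finset ℕ) := by
    intro i _ j _ hij
    simp only [hv] at hij
    have h : (i : ℝ) = j := by
      field_simp at hij
      linarith
    exact_mod_cast h
  have hdeg : p.degree < #(range (n + 1)) := by
    rw [Finset.card_range]
    exact lt_of_le_of_lt (Polynomial.degree_le_of_natDegree_le hp) (by exact_mod_cast Nat.lt_succ_self n)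
  have heq := Lagrange.eq_interpolate hinj hdeg
  rw [Lagrange.interpolate_apply] at heq
  -- the basis polynomials: degree `≤ n`, cost `≤ nⁿ·D`
  have hbasis : ∀ j ∈ range (n + 1),
      |∫ x, (Lagrange.basis (range (n + 1)) v j).eval x ∂ν - ∫ x, (Lagrange.basis (range (n + 1)) v j).eval x ∂μ| ≤ (n : ℝ) ^ n * D := by
    intro j hj
    have hdj : (Lagrange.basis (range (n + 1)) v j).natDegree ≤ n := by
      rw [Lagrange.natDegree_basis hinj hj, Finset.card_range, Nat.add_sub_cancel]
    refine (abs_integral_eval_sub_le hμ hν hD0 hD hdj).trans ?_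
    exact mul_le_mul_of_nonneg_right (sum_abs_coeff_lagrange_basis_le hn hj n) hD0
  -- integrate the Lagrange form termwise
  have hlin : ∀ (κ : Measure ℝ) [IsProbabilityMeasure κ], κ (Set.Icc (-1) 1)ᶜ = 0 →
      ∫ x, p.eval x ∂κ = ∑ j ∈ range (n + 1), p.eval (v j) * ∫ x, (Lagrange.basis (range (n + 1)) v j).eval x ∂κ := by
    intro κ _ hκ
    have he : ∀ x : ℝ, p.eval x = ∑ j ∈ range (n + 1), p.eval (v j) * (Lagrange.basis (range (n + 1)) v j).eval x := by
      intro x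
      conv_lhs => rw [heq]
      rw [Polynomial.eval_finsetSum]
      exact sum_congr rfl fun j _ => by rw [Polynomial.eval_mul, Polynomial.eval_C]
    rw [integral_congr_ae (ae_of_all κ he)]
    rw [integral_finsetSum _ fun j _ =>
      (integrable_of_continuous_Icc_symm hκ (Polynomial.continuous _)).const_mul _]
    exact sum_congr rfl fun j _ => integral_const_mul _ _
  rw [hlin ν hν, hlin μ hμ, ← sum_sub_distrib]
  calc |∑ j ∈ range (n + 1), (p.eval (v j) * ∫ x, (Lagrange.basis (range (n + 1)) v j).eval x ∂ν -
          p.eval (v j) * ∫ x, (Lagrange.basis (range (n + 1)) v j).eval x ∂μ)|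
      ≤ ∑ j ∈ range (n + 1), |p.eval (v j) * ∫ x, (Lagrange.basis (range (n + 1)) v j).eval x ∂ν -
          p.eval (v j) * ∫ x, (Lagrange.basis (range (n + 1)) v j).eval x ∂μ| := abs_sum_le_sum_abs _ _
    _ ≤ ∑ j ∈ range (n + 1), P * ((n : ℝ) ^ n * D) := by
        refine sum_le_sum fun j hj => ?_
        rw [← mul_sub, abs_mul]
        exact mul_le_mul (hP j hj) (hbasis j hj) (abs_nonneg _) hP0
    _ = (n + 1) * P * (n : ℝ) ^ n * D := by
        rw [sum_const, Finset.card_range, nsmul_eq_mul]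
        push_cast
        ring

end Laws

/-! ## §4 THE LAW-LEVEL PRICE FROM ABOVE ON THE JACKSON ROAD -/

section Price

variable {μ ν : Measure ℝ} [IsProbabilityMeasure μ] [IsProbabilityMeasure ν]

/-- p546312 §2 for laws on `[−1,1]`, uniformly over the orders `1 ≤ i ≤ n`: `|∫xⁱ dν − ∫xⁱ dμ| ≤ n!·2εe^{l₀}·Aⁿ`, `A = max(1, 2e·max(1,L)∕l₀)`.
[folklore] -/
theorem abs_moment_sub_le_uniform_symm (hμ : μ (Set.Icc (-1) 1)ᶜ = 0) (hν : ν (Set.Icc (-1) 1)ᶜ = 0) {ε l₀ : ℝ} (hl₀ : 0 < l₀)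
    (hε0 : 0 ≤ ε) (hε : ∀ t : ℝ, |t| ≤ l₀ → |cgf id ν t - cgf id μ t| ≤ ε) {n i : ℕ} (hi1 : 1 ≤ i) (hi : i ≤ n) :
    |∫ x, x ^ i ∂ν - ∫ x, x ^ i ∂μ| ≤
      n.factorial * (2 * ε * Real.exp l₀) * (max 1 (2 * Real.exp 1 * max 1 (Real.posLog ε⁻¹) / l₀)) ^ n := by
  have h := abs_moment_sub_le_of_cgf_close (μ := μ) (ν := ν) (X := id) (Y := id) (B := 1) aemeasurable_id aemeasurable_id
    (ae_abs_le_one_of_Icc_symm hμ) (ae_abs_le_one_of_Icc_symm hν) hl₀ hε0 hε hi1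
  simp only [id, mul_one] at h
  refine h.trans ?_
  have hA1 : 1 ≤ max 1 (2 * Real.exp 1 * max 1 (Real.posLog ε⁻¹) / l₀) := le_max_left _ _
  have hbase : 2 * Real.exp 1 * max 1 (Real.posLog ε⁻¹ / i) / l₀ ≤ max 1 (2 * Real.exp 1 * max 1 (Real.posLog ε⁻¹) / l₀) := by
    refine le_trans ?_ (le_max_right _ _)
    gcongr
    have hi1r : (1 : ℝ) ≤ i := by exact_mod_cast hi1
    exact div_le_self Real.posLog_nonneg hi1r
  calc (i.factorial : ℝ) * (2 * ε * Real.exp l₀) * (2 * Real.exp 1 * max 1 (Real.posLog ε⁻¹ / i) / l₀) ^ i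
      ≤ n.factorial * (2 * ε * Real.exp l₀) * (max 1 (2 * Real.exp 1 * max 1 (Real.posLog ε⁻¹) / l₀)) ^ i := by
        gcongr
    _ ≤ n.factorial * (2 * ε * Real.exp l₀) * (max 1 (2 * Real.exp 1 * max 1 (Real.posLog ε⁻¹) / l₀)) ^ n := by
        gcongr

/-- **★★ THE LAW-LEVEL PRICE FROM ABOVE ON THE JACKSON ROAD (explicit, every degree `n`).**  Two probability laws `μ, ν` on `[−1,1]` with cgf's
`ε`-close on `|t| ≤ l₀` (`0 < l₀`, `0 ≤ ε`), a test function `g`, `K`-Lipschitz with `|g| ≤ G` on `[−1,1]`.  Then for every `n ≥ 1`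
`|∫ g dν − ∫ g dμ| ≤ 16K∕n + (n+1)·(G + 8K∕n)·nⁿ·(n!·2εe^{l₀}·Aⁿ)`, `A = max(1, 2e·max(1, log⁺ε⁻¹)∕l₀)` — §1's Jackson polynomial of degree `≤ n`
(uniform error `8K∕n` on `[−1,1]`, where both laws live) priced by §3 at the moment currency of p546312 §2.  The rate in `n` is `1∕n` (Jackson), not the
`1∕√n` of p546312's Bernstein road; the conversion factor `(n+1)nⁿ` is of the order `e^{O(n log n)}` the currency `n!·Aⁿ` already carries, so the
optimisation `n ≍ (1+L)∕log(e+L)` of the sibling `…N19LawPriceTwoSided` yields `C(l₀)(K+G)·log(e+L)∕(1+L)` — the lower rate of `…N19LawPriceLowerRate`.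
[folklore] -/
theorem abs_integral_sub_integral_le_lipschitz_jackson (hμ : μ (Set.Icc (-1) 1)ᶜ = 0) (hν : ν (Set.Icc (-1) 1)ᶜ = 0)
    {ε l₀ : ℝ} (hl₀ : 0 < l₀) (hε0 : 0 ≤ ε) (hε : ∀ t : ℝ, |t| ≤ l₀ → |cgf id ν t - cgf id μ t| ≤ ε)
    {g : ℝ → ℝ} {K : NNReal} (hg : LipschitzWith K g) {G : ℝ} (hG : ∀ x ∈ Set.Icc (-1 : ℝ) 1, |g x| ≤ G) {n : ℕ} (hn : 1 ≤ n) :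
    |∫ x, g x ∂ν - ∫ x, g x ∂μ| ≤
      16 * K / n + (n + 1) * (G + 8 * K / n) * (n : ℝ) ^ n *
        (n.factorial * (2 * ε * Real.exp l₀) * (max 1 (2 * Real.exp 1 * max 1 (Real.posLog ε⁻¹) / l₀)) ^ n) := by
  have hn0 : 0 < n := hn
  have hnr : (0 : ℝ) < n := by exact_mod_cast hn
  have hgc : Continuous g := hg.continuous
  -- Jackson polynomial on `[−1, 1]`
  obtain ⟨p, hp, hgp⟩ := exists_poly_near_of_lipschitzWith hg (by norm_num : (-1 : ℝ) ≤ 1) hn0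
  have hgp' : ∀ x ∈ Set.Icc (-1 : ℝ) 1, |g x - p.eval x| ≤ 8 * K / n := fun x hx => by
    have h := hgp x hx; norm_num at h; linarith
  -- `g − p` integrates to at most `8K∕n` under each law
  have hae : ∀ (κ : Measure ℝ), κ (Set.Icc (-1) 1)ᶜ = 0 → ∀ᵐ x ∂κ, x ∈ Set.Icc (-1 : ℝ) 1 := fun κ hκ => by
    rw [ae_iff]
    simpa only [Set.mem_Icc, Set.compl_def] using hκ
  have hint : ∀ (κ : Measure ℝ) [IsProbabilityMeasure κ], κ (Set.Icc (-1) 1)ᶜ = 0 →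
      |∫ x, g x ∂κ - ∫ x, p.eval x ∂κ| ≤ 8 * K / n := by
    intro κ _ hκ
    rw [← integral_sub (integrable_of_continuous_Icc_symm hκ hgc) (integrable_of_continuous_Icc_symm hκ (Polynomial.continuous p))]
    have h := norm_integral_le_of_norm_le_const (μ := κ) (f := fun x => g x - p.eval x) (C := 8 * K / n)
      ((hae κ hκ).mono fun x hx => by rw [Real.norm_eq_abs]; exact hgp' x hx)
    rwa [probReal_univ, mul_one, Real.norm_eq_abs] at h
  -- the node values of `p`
  have hnodes : ∀ j ∈ range (n + 1), |p.eval (-1 + 2 * (j : ℝ) / n)| ≤ G + 8 * K / n := by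
    intro j hj
    have hj' : (j : ℝ) ≤ n := by exact_mod_cast Nat.lt_succ_iff.mp (mem_range.mp hj)
    have h0j : (0 : ℝ) ≤ 2 * (j : ℝ) / n := by positivity
    have h2j : 2 * (j : ℝ) / n ≤ 2 := by rw [div_le_iff₀ hnr]; linarith
    have hmem : (-1 + 2 * (j : ℝ) / n) ∈ Set.Icc (-1 : ℝ) 1 := ⟨by linarith, by linarith⟩
    have h1 := hgp' _ hmem
    have h2 := hG _ hmem
    rw [abs_sub_comm] at h1
    calc |p.eval (-1 + 2 * (j : ℝ) / n)| = |(p.eval (-1 + 2 * (j : ℝ) / n) - g (-1 + 2 * (j : ℝ) / n)) + g (-1 + 2 * (j : ℝ) / n)| := by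
          ring_nf
      _ ≤ |p.eval (-1 + 2 * (j : ℝ) / n) - g (-1 + 2 * (j : ℝ) / n)| + |g (-1 + 2 * (j : ℝ) / n)| := abs_add_le _ _
      _ ≤ 8 * K / n + G := add_le_add h1 h2
      _ = G + 8 * K / n := add_comm _ _
  -- the moment currency
  set D : ℝ := (n.factorial : ℝ) * (2 * ε * Real.exp l₀) * (max 1 (2 * Real.exp 1 * max 1 (Real.posLog ε⁻¹) / l₀)) ^ n with hD
  have hD0 : 0 ≤ D := by positivity
  have hDi : ∀ i : ℕ, 1 ≤ i → i ≤ n → |∫ x, x ^ i ∂ν - ∫ x, x ^ i ∂μ| ≤ D := fun i hi1 hi =>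
    abs_moment_sub_le_uniform_symm hμ hν hl₀ hε0 hε hi1 hi
  have hpp := abs_integral_eval_sub_le_of_nodes hμ hν hn0 hD0 hDi hp hnodes
  -- assemble
  have e : ∫ x, g x ∂ν - ∫ x, g x ∂μ =
      (∫ x, g x ∂ν - ∫ x, p.eval x ∂ν) - (∫ x, g x ∂μ - ∫ x, p.eval x ∂μ) + (∫ x, p.eval x ∂ν - ∫ x, p.eval x ∂μ) := by ring
  rw [e]
  calc |(∫ x, g x ∂ν - ∫ x, p.eval x ∂ν) - (∫ x, g x ∂μ - ∫ x, p.eval x ∂μ) + (∫ x, p.eval x ∂ν - ∫ x, p.eval x ∂μ)|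
      ≤ |∫ x, g x ∂ν - ∫ x, p.eval x ∂ν| + |∫ x, g x ∂μ - ∫ x, p.eval x ∂μ| + |∫ x, p.eval x ∂ν - ∫ x, p.eval x ∂μ| := by
        refine (abs_add_le _ _).trans (add_le_add (abs_sub _ _) le_rfl)
    _ ≤ 8 * K / n + 8 * K / n + (n + 1) * (G + 8 * K / n) * (n : ℝ) ^ n * D :=
        add_le_add (add_le_add (hint ν hν) (hint μ hμ)) hpp
    _ = 16 * K / n + (n + 1) * (G + 8 * K / n) * (n : ℝ) ^ n * D := by ring

end Price



end Summit.QuantumFields.YangMills.Theorems.BalabanUVNodesN19LawPriceJackson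

end
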